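import Mathlib.Algebra.BigOperators.Group.Finset.Basic
import Mathlib.Algebra.BigOperators.Group.Finset.Piecewise
import Mathlib.Algebra.Order.BigOperators.Group.Finset
import Mathlib.Data.Finset.Powerset
import Mathlib.Data.Fintype.Powerset
import Mathlib.Data.Fin.Basic
import Mathlib.Order.WellFounded
import HarnessLib

/-!
# [OURS · L1 W4.2] The toric shadow of the CORE: the CJS label walk on binomial threefolds
# `y^m + x₁^{a₁} x₂^{a₂} x₃^{a₃}` as a vertex game — DEFINITIONS (statement-only)
# campaign s42 of cell res-hironaka (LADDER-RESOLUTION rung L, D-0089); host route HilbertSamuelElimination (DRAFT),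
# `--kind definition --supports stmt-ResolutionOfSingularities-19965`

HONEST FRAMING. Everything here is OURS (prover seat res-L1-s42-pv-2, slot W4.2 «tertiary invariant / obstruction O2»).
NOTHING here is a statement of H. Hironaka's manuscript [Hironaka2017]; nothing is asserted (statement-only file: `def`s and
one `structure`; the sorry-free proofs are the sibling files `…CampaignW42VertexGameRank.lean` /
`…CampaignW42VertexGameTermination.lean`). AI-made; AI review is weaker than expert review.

WHAT THIS IS. The chain's CORE row `stub_Wtop3M_nonpointed` / the O2 items `CampaignW42NearChainTermination`
(stmt-…-19964) and `CampaignW42TertiaryTermination` (stmt-…-19965) ask that the canonical Hilbert–Samuel walk of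
Cossart–Jannsen–Saito (LNM 2270, Rem. 6.29 (1): blow up the OLDEST-labelled components of the maximal Hilbert–Samuel stratum,
after separating them) admits no infinite chain of closed near points when the geometric directrix dimension is `3`. On the
toric family `X = V(y^m + x₁^{a₁} x₂^{a₂} x₃^{a₃}) ⊂ 𝔸⁴` (every member with `a₁ + a₂ + a₃ > m` starts at `ē = 3`, i.e. in
the CORE's territory) the walk, followed at the torus-fixed closed points, is an exact COMBINATORIAL GAME on the exponent
vector `a ∈ ℕ³` together with the CJS labels of the stratum components through the tracked point — the model
`binom_model.py` of the seat's calibration memo (CALIBRATION-W42-O2-v2.md §3d), validated edge-by-edge against the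
chain's Gröbner-basis engine (res-L0-k42 `k42_hswalk.py` v7) on 30 904 genuine near steps (kit jobs j270062, j270545;
0 discrepancies). Stripped of labels it is Hironaka's polyhedra game [Spivakovsky1983] for the ONE-VERTEX polyhedron
`a/m + ℝ³_{≥0}`: a centre is an index set `U ⊆ {0,1,2}` with `a_U := Σ_{i ∈ U} a_i ≥ m` (the coordinate subspace
`V(y, x_U)` lies in the multiplicity-`m` locus), the chart `c ∈ U` of its blow-up replaces `a_c` by `a_U − m`, and the
point is resolved once `a₀ + a₁ + a₂ < m`. With INCLUSION-MINIMAL centres the order `a₀ + a₁ + a₂` drops at every move;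
the CJS strategy, however, also blows up INTERSECTIONS of equally-labelled components (its arrangement-resolution
sub-process), under which the order can rise (memo §3c: on 1 369 of 10 950 recorded steps). This file types that game
exactly; the sibling files prove that EVERY play is finite (`labelStrategyWins`), by the well-founded invariant
`(|a| − [one oldest component] · its excess, #oldest components, Σ their excesses)` found and z3-certified this session
(kit j272088) — the binomial instance of the chain's sub-object (N-4)/`StrataBirthsSettle` («births vs deaths»).

WHAT THIS IS NOT. Not a theorem about schemes: the dictionary «component of `X(ν)` through the point ↔ minimal `S` with
`a_S ≥ m`», «CJS canonical centre ↔ `IsCentre`», «closed near points of the first kind ↔ charts `c ∈ U`» is the content of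
the validated model, not of a Lean proof; non-torus-fixed closed points of the exceptional fibre («unit-forgetting») are
in the z3 certificate but not in this file. Calibration stays calibration: the items 19964/19965 and the CORE are OPEN.

## The game (namespace `…Theorems.CampaignW42.VertexGame`)
* `State` — exponents `a : Fin 3 → ℕ` and a label book `lab : Finset (Fin 3) → ℕ` (only its values on components matter).
* `IsBig m a S` (`m ≤ a_S`), `comps m a` — the COMPONENTS through the point: inclusion-minimal nonempty big index sets
  (= the irreducible components `V(y, x_S)` of the multiplicity-`m` locus through the origin), `IsComp`.
* `leastClass m s` — the components carrying the least (= oldest) label; `fresh m s` — a label newer than all current ones.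
* `IsCentre m s isEnd U` — the CJS choice: if the oldest class is a single component `S₀`, blow it up (`isEnd = true`,
  `U = S₀`); otherwise blow up a flat of the arrangement of the oldest components, i.e. the intersection
  `V(y, x_U)`, `U` = the union of ≥ 2 of their index sets (CJS takes all of them; any ≥ 2 is allowed here).
* `transform m a U c` — the exponents at the origin of chart `c ∈ U`; `newLabel` — CJS bookkeeping: a component avoiding
  `c` is the strict transform of the same old component (label kept); a component containing `c` lies in the exceptional
  divisor: it inherits the old label iff the move was `END` and it dominates the centre (`S ⊆ U`), else it is NEW (`fresh`).
* `Step m s s'` — one move followed into one chart; `LabelStrategyWins m` — [OURS] every play is finite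
  (`WellFounded (flip (Step m))`); proved for `0 < m` in `…VertexGameTermination.lean` (for `m = 0` the game never ends).
-/

set_option linter.dupNamespace false -- mandated namespace of this single-conjunct summit

namespace Summit.ResolutionOfSingularities.ResolutionOfSingularities.Theorems

namespace CampaignW42.VertexGame

open Finset

/-- [OURS · L1 W4.2] A position of the vertex game: the exponent vector `a = (a₀, a₁, a₂)` of the local equation
`y^m + x₀^{a₀} x₁^{a₁} x₂^{a₂}` at the tracked point, and the CJS label book `lab` (year labels of the stratum
components through the point, indexed by their coordinate index sets; values on non-components are irrelevant).
Replaces the role of: a marked stage of `S(X, ν)` on the binomial family; NOT a statement of the manuscript. [folklore] -/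
structure State where
  /-- exponents of the monomial `x^a` [folklore] -/
  a : Fin 3 → ℕ
  /-- label book: `lab S` = the CJS label of the component `V(y, x_S)` when `S` is a component [folklore] -/
  lab : Finset (Fin 3) → ℕ

/-- [OURS · L1 W4.2] `a_S ≥ m`: the coordinate subspace `V(y, x_S)` lies in the multiplicity-`m` locus of
`y^m + x^a`. [folklore] -/
def IsBig (m : ℕ) (a : Fin 3 → ℕ) (S : Finset (Fin 3)) : Prop :=
  m ≤ ∑ i ∈ S, a i

/-- [OURS · L1 W4.2] The components through the point: the inclusion-minimal nonempty index sets `S` with `a_S ≥ m`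
(the irreducible components `V(y, x_S)` of the maximal Hilbert–Samuel = multiplicity-`m` stratum of `y^m + x^a`
through the origin). An antichain of nonempty subsets of `{0,1,2}`: planes `{k}`, lines `{i,j}`, the point `{0,1,2}`. [folklore] -/
def comps (m : ℕ) (a : Fin 3 → ℕ) : Finset (Finset (Fin 3)) :=
  (Finset.univ : Finset (Finset (Fin 3))).filter fun S =>
    S.Nonempty ∧ m ≤ ∑ i ∈ S, a i ∧ ∀ T ∈ S.ssubsets, T.Nonempty → ∑ i ∈ T, a i < m

/-- [OURS · L1 W4.2] `S` is a component through the point (membership in `comps`, as a predicate). [folklore] -/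
def IsComp (m : ℕ) (a : Fin 3 → ℕ) (S : Finset (Fin 3)) : Prop :=
  S ∈ comps m a

/-- [OURS · L1 W4.2] The oldest class: the components through the point whose label is least among the labels of
all components through the point (CJS: the components of `X(ν)` of the smallest year label). Empty iff the point is
resolved (`a₀ + a₁ + a₂ < m`). [folklore] -/
def leastClass (m : ℕ) (s : State) : Finset (Finset (Fin 3)) :=
  (comps m s.a).filter fun S => ∀ T ∈ comps m s.a, s.lab S ≤ s.lab T

/-- [OURS · L1 W4.2] A fresh label: strictly newer (larger) than the label of every component through the point. [folklore] -/
def fresh (m : ℕ) (s : State) : ℕ :=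
  (comps m s.a).sup s.lab + 1

/-- [OURS · L1 W4.2] The CJS choice of centre at the tracked point. `end_`: the oldest class is a single component
`S₀` — blow up `V(y, x_{S₀})` (`isEnd = true`). `arr`: the oldest class has ≥ 2 members — blow up a flat of their
arrangement through the point, the intersection `V(y, x_U)` with `U` the union of the index sets of ≥ 2 oldest
components (`isEnd = false`; CJS's own choice, all of them, is the case `sub = leastClass m s`). [folklore] -/
inductive IsCentre (m : ℕ) (s : State) : Bool → Finset (Fin 3) → Prop
  | end_ (S₀ : Finset (Fin 3)) (h : leastClass m s = {S₀}) : IsCentre m s true S₀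
  | arr (sub : Finset (Finset (Fin 3))) (hsub : sub ⊆ leastClass m s) (hcard : 2 ≤ sub.card) :
      IsCentre m s false (sub.biUnion id)

/-- [OURS · L1 W4.2] The exponents at the origin of the chart `c ∈ U` of the blow-up of `V(y, x_U)`:
`a_c ↦ a_U − m`, the other exponents unchanged (strict transform `y'^m + x^{a'}` of `y^m + x^a`). [folklore] -/
def transform (m : ℕ) (a : Fin 3 → ℕ) (U : Finset (Fin 3)) (c : Fin 3) : Fin 3 → ℕ :=
  Function.update a c (∑ i ∈ U, a i - m)

/-- [OURS · L1 W4.2] CJS label bookkeeping after the move `(isEnd, U)` followed into chart `c`, for an index set `S`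
that is a component at the new point: if `c ∉ S` it is the strict transform of the old component `S` (label kept); if
`c ∈ S` it lies in the new exceptional divisor and inherits the centre's label iff the move was `END` and `S ⊆ U`
(it dominates the blown-up component), otherwise it is a NEW component and gets the fresh label. [folklore] -/
def newLabel (m : ℕ) (s : State) (isEnd : Bool) (U : Finset (Fin 3)) (c : Fin 3) (S : Finset (Fin 3)) : ℕ :=
  if c ∉ S then s.lab S else if isEnd = true ∧ S ⊆ U then s.lab U else fresh m s

/-- [OURS · L1 W4.2] One move of the game followed into one chart: a CJS centre `U` at `s`, a chart `c ∈ U`, the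
transformed exponents, and a label book agreeing with the CJS bookkeeping on every component of the new position
(labels of non-components are unconstrained). A resolved position (`comps = ∅`) has no centre, hence no move. [folklore] -/
def Step (m : ℕ) (s s' : State) : Prop :=
  ∃ (isEnd : Bool) (U : Finset (Fin 3)) (c : Fin 3), IsCentre m s isEnd U ∧ c ∈ U ∧
    s'.a = transform m s.a U c ∧ ∀ S ∈ comps m s'.a, s'.lab S = newLabel m s isEnd U c S

/-- [OURS · L1 W4.2] «The CJS label strategy wins the one-vertex polyhedra game in dimension 3»: there is no infinite
play `s₀ → s₁ → s₂ → …` of `Step m` — from every position (every exponent vector, EVERY labelling), against every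
sequence of charts. Replaces the role of: the CORE row `stub_Wtop3M_nonpointed` / the items
`CampaignW42NearChainTermination`, `CampaignW42TertiaryTermination` ON THE BINOMIAL FAMILY at torus-fixed points
(RESCUE-SEED W4.2, CRUX-PLAN w42 v3.6 §000000 (5)(a)); NOT a statement of the manuscript. Proved for `0 < m`
(`labelStrategyWins`); false for `m = 0`. [folklore] -/
def LabelStrategyWins (m : ℕ) : Prop :=
  WellFounded (flip (Step m))

end CampaignW42.VertexGame

end Summit.ResolutionOfSingularities.ResolutionOfSingularities.Theorems
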